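import Literature.NumberTheory.Automorphic.ChevalleyIsomorphismLie
import Literature.NumberTheory.Automorphic.LieCentralizerTorusHolds
import HarnessLib

/-!
# `chevalley_isomorphism` from step 1 of Springer's proof alone
(trunk T-AUTOMORPHIC, G25 AutomorphicL; DAG of `Literature.NumberTheory.Automorphic.chevalley_isomorphism`)

Assembly file (namespace `Literature.NumberTheory.Automorphic`). `ChevalleyIsomorphismLie.lean`
proved `chevalley_isomorphism_of_lieWeightSpace_one_le`: the named fact
`Literature.NumberTheory.Automorphic.chevalley_isomorphism` — the existence clause of the
isomorphism theorem, Springer, *Linear Algebraic Groups*, 2nd ed., Thm. 9.6.2, in the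
characteristic `0` of the statement — follows from `chevalley_isomorphism_abstract` (step 1 of
Springer's proof: an isomorphism of *abstract* groups inducing the identity of the root datum,
9.4.3 with 9.5.4) and the named fact `lieWeightSpace_one_le_lieAlgebraGL` (`𝔤^T ⊆ L(T)`,
Springer 5.4.7 with 7.6.4 (ii)) for `(G, T)` and `(G', T')`. The latter is now a theorem in
characteristic `0` (`lieWeightSpace_one_le_lieAlgebraGL_holds`, `LieCentralizerTorusHolds.lean`:
Jordan decomposition in `Lie(G)`, algebraic hulls, Engel, Cartan's criterion), so:

* **`chevalley_isomorphism_of_abstract`** — `chevalley_isomorphism_abstract → chevalley_isomorphism`.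
  Step 1 is the whole remaining trust base of `chevalley_isomorphism`; everything in step 2 of
  the printed proof (8.1.1 (i), 8.1.2, 8.1.3 (ii), 8.2.1, 8.3.11, the algebraicity on translates of
  the big cell) is proved.

## References

* [SpringerLAG1998] T. A. Springer, *Linear Algebraic Groups*, 2nd ed., Progress in
  Mathematics 9, Birkhäuser (1998): Thm. 9.6.2 and its proof (§9.6), Cor. 5.4.7, Cor. 7.6.4 (ii).
-/

noncomputable section

open scoped MatrixGroups IsMulCommutative

namespace Literature.NumberTheory.Automorphic

variable {k : Type*} [Field k]
variable {ι X Y : Type*} [AddCommGroup X] [AddCommGroup Y]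
variable {N N' : ℕ} {G T : Subgroup (GL (Fin N) k)} {G' T' : Subgroup (GL (Fin N') k)}
  [IsMulCommutative ↥T] [IsMulCommutative ↥T']

/-- **`chevalley_isomorphism` from step 1 of Springer's proof of 9.6.2 alone.** Given the abstract
isomorphism of step 1 (`chevalley_isomorphism_abstract`), the isomorphism theorem
`chevalley_isomorphism` holds: the hypothesis `𝔤^T ⊆ L(T)` of
`chevalley_isomorphism_of_lieWeightSpace_one_le` is discharged in characteristic `0` by
`lieWeightSpace_one_le_lieAlgebraGL_holds` for `(G, T)` and `(G', T')`.
[cite: SpringerLAG1998, 9.6.2 (proof) with 5.4.7, 7.6.4 (ii), 8.1.1–8.3.11] -/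
theorem chevalley_isomorphism_of_abstract
    (hA : chevalley_isomorphism_abstract (k := k) (ι := ι) (X := X) (Y := Y) (G := G) (T := T)
      (G' := G') (T' := T')) :
    chevalley_isomorphism (k := k) (ι := ι) (X := X) (Y := Y) (G := G) (T := T) (G' := G')
      (T' := T') := by
  intro _ _ hG hT hG' hT' P eX eY eX' eY' h h'
  exact chevalley_isomorphism_of_lieWeightSpace_one_le hA
    (lieWeightSpace_one_le_lieAlgebraGL_holds G T) (lieWeightSpace_one_le_lieAlgebraGL_holds G' T')
    hG hT hG' hT' h h'

end Literature.NumberTheory.Automorphic
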